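import Mathlib
import HarnessLib
import Literature.Analysis.Convex.MoreauConeDecomposition

/-!
# The metric projection onto a complete convex set of a real inner product space

Literature anchor (statements and proofs follow the source; nothing here is new mathematics):

* [Deu01] F. Deutsch, *Best Approximation in Inner Product Spaces*, CMS Books in Mathematics 7,
  Springer 2001, doi:10.1007/978-1-4684-9298-9 (held: `lit` key
  `book:deutsch2001-best-approximation-inner-product-spaces`): **Thm 2.4** (uniqueness of best
  approximations from convex sets), **Thm 3.4 (2)** (every complete convex set is Chebyshev: each `x`
  has exactly one nearest point `P_K(x)`), **Thm 4.1** (characterization: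
  `y₀ = P_K(x) ⟺ y₀ ∈ K ∧ ⟨x − y₀, y − y₀⟩ ≤ 0 ∀ y ∈ K`), **Thm 5.3** (the distance function
  `x ↦ d(x, K)` is nonexpansive), **Thm 5.5** (`P_K` is (1) idempotent, (2) firmly nonexpansive
  `⟨x − y, P_K x − P_K y⟩ ≥ ‖P_K x − P_K y‖²`, (3) monotone, (4) "strictly nonexpansive"
  `‖x − y‖² ≥ ‖P_K x − P_K y‖² + ‖(x − P_K x) − (y − P_K y)‖²`, (5) nonexpansive, (6) uniformly
  continuous), **Thm 9.39** (best approximation from a half-space `H = {y : ⟨y, z⟩ ≤ c}`: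
  `P_H(x) = x − ([⟨x, z⟩ − c]⁺/‖z‖²) z`, `d(x, H) = [⟨x, z⟩ − c]⁺/‖z‖`) (bib: Deutsch2001);
* [GK90] K. Goebel, W. A. Kirk, *Topics in Metric Fixed Point Theory*, Cambridge Studies in
  Advanced Mathematics 28, CUP 1990, doi:10.1017/cbo9780511526152 (held: `lit` key
  `book:goebel1990-topics-metric-fixed-point-theory`, §12): **Thm 12.1** ((d) ⇒ (b): a map `T` with
  `⟨T x − T y, x − y⟩ ≥ ‖T x − T y‖²` has `2T − I` nonexpansive) and **Thm 12.2** (`P_K` is a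
  firmly nonexpansive retraction onto `K`, `I − P_K` is nonexpansive and monotone, and the
  reflection `2 P_K − I` is nonexpansive) (bib: GoebelKirk1990).

Everything is proved; there are no named facts and no `sorry`.

## What is formalised

`E` is a real inner product space; `K : Set E` is nonempty, complete and convex (the hypotheses of
Thm 3.4 (2); in a Hilbert space: nonempty closed convex, Thm 3.5). Existence of nearest points and
the variational characterization are Mathlib's `exists_norm_eq_iInf_of_complete_convex` and
`norm_eq_iInf_iff_real_inner_le_zero`; this file packages them as a total function
`proj K : E → E` (by cases on existence, so that no hypothesis is an argument of the function) and
records [Deu01]'s numbered statements about it: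

* `proj_mem`, `norm_sub_proj_eq_iInf`, `norm_sub_proj_le` (Thm 3.4 (2): `P_K x ∈ K` is a nearest
  point), `eq_proj_of_norm_sub_le` (Thm 2.4: it is the only one);
* `inner_sub_proj_le_zero`, `eq_proj_of_inner_le_zero`, `eq_proj_iff` (Thm 4.1);
* `proj_eq_self`, `proj_proj`, `proj_eq_self_iff` (Thm 5.5 (1)), `norm_proj_sub_proj_sq_le_inner`
  ((2)), `inner_sub_proj_sub_proj_nonneg` ((3)), `norm_proj_sub_proj_sq_add_le` ((4)),
  `norm_proj_sub_proj_le`, `lipschitzWith_proj`, `uniformContinuous_proj`, `continuous_proj`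
  ((5), (6)); `abs_norm_sub_proj_sub_le` (Thm 5.3);
* [GK90] Thm 12.1 (d) ⇒ (b) for an arbitrary map, `norm_two_smul_sub_le_of_sq_le_inner`, and
  Thm 12.2: `I − P_K` is nonexpansive (`norm_sub_proj_sub_le`) and monotone
  (`inner_sub_proj_sub_nonneg`), and the reflection `2 P_K − I` is nonexpansive
  (`norm_reflect_sub_reflect_le`, the form used by Douglas–Rachford / averaged-projection
  iterations);
* `proj_halfspace_eq`, `norm_sub_proj_halfspace_eq` (Thm 9.39 (2), in a Hilbert space);
* the dictionary to the cone case already in the tree: `moreauProj_eq_proj`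
  (`Literature.Analysis.Convex.MoreauDecomposition.proj K x = proj ↑K x` for a `ProperCone`, by the
  uniqueness of best approximations, Thm 2.4).

Deviations: [Deu01] writes `P_K` for the set-valued metric projection of an arbitrary set and
proves Chebyshev-ness; here `proj` is only ever evaluated under the Thm 3.4 (2) hypotheses, where it
is single-valued. Subspace projections are Mathlib's `orthogonalProjection` and are not repeated;
Dykstra / von Neumann alternating projections (Ch. 9) are not formalised here.
-/

open Filter Topology
open scoped RealInnerProductSpace

namespace Literature.Analysis.Convex.ConvexMetricProjection

variable {E : Type*} [NormedAddCommGroup E] [InnerProductSpace ℝ E]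

open Classical in
/-- The **metric projection** `P_K(x)`: the nearest point of `K` to `x` when one exists (it does,
uniquely, for `K` nonempty complete convex — Thm 3.4 (2)), and `x` otherwise (junk value, never
used). [cite: Deutsch2001, Thm 3.4] -/
noncomputable def proj (K : Set E) (x : E) : E :=
  if h : ∃ y ∈ K, ‖x - y‖ = ⨅ w : K, ‖x - (w : E)‖ then h.choose else x

variable {K : Set E} {x y y₀ : E}

/-! ## Existence and minimality (Theorem 3.4 (2)) and uniqueness (Theorem 2.4) -/

/-- Under the hypotheses of Thm 3.4 (2), `P_K(x) ∈ K` and `‖x − P_K(x)‖ = d(x, K)`.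
[cite: Deutsch2001, Thm 3.4] -/
theorem proj_spec (hne : K.Nonempty) (hc : IsComplete K) (hK : Convex ℝ K) (x : E) :
    proj K x ∈ K ∧ ‖x - proj K x‖ = ⨅ w : K, ‖x - (w : E)‖ := by
  have h := exists_norm_eq_iInf_of_complete_convex hne hc hK x
  simp only [proj, dif_pos h]
  exact h.choose_spec

/-- `P_K(x) ∈ K`. [cite: Deutsch2001, Thm 3.4] -/
theorem proj_mem (hne : K.Nonempty) (hc : IsComplete K) (hK : Convex ℝ K) (x : E) :
    proj K x ∈ K :=
  (proj_spec hne hc hK x).1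

/-- `‖x − P_K(x)‖ = d(x, K) = inf_{w ∈ K} ‖x − w‖`. [cite: Deutsch2001, Thm 3.4] -/
theorem norm_sub_proj_eq_iInf (hne : K.Nonempty) (hc : IsComplete K) (hK : Convex ℝ K) (x : E) :
    ‖x - proj K x‖ = ⨅ w : K, ‖x - (w : E)‖ :=
  (proj_spec hne hc hK x).2

/-- `P_K(x)` is a best approximation: `‖x − P_K(x)‖ ≤ ‖x − y‖` for every `y ∈ K`.
[cite: Deutsch2001, Thm 3.4] -/
theorem norm_sub_proj_le (hne : K.Nonempty) (hc : IsComplete K) (hK : Convex ℝ K) (x : E)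
    (hy : y ∈ K) : ‖x - proj K x‖ ≤ ‖x - y‖ := by
  rw [norm_sub_proj_eq_iInf hne hc hK x]
  have hb : BddBelow (Set.range fun w : K => ‖x - (w : E)‖) :=
    ⟨0, by rintro _ ⟨w, rfl⟩; exact norm_nonneg _⟩
  exact ciInf_le hb ⟨y, hy⟩

/-! ## Characterization (Theorem 4.1) -/

/-- **Thm 4.1 (⇒)**, the variational inequality: `⟨x − P_K(x), y − P_K(x)⟩ ≤ 0` for all `y ∈ K`.
[cite: Deutsch2001, Thm 4.1] -/
theorem inner_sub_proj_le_zero (hne : K.Nonempty) (hc : IsComplete K) (hK : Convex ℝ K) (x : E)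
    (hy : y ∈ K) : ⟪x - proj K x, y - proj K x⟫ ≤ 0 :=
  (norm_eq_iInf_iff_real_inner_le_zero hK (proj_mem hne hc hK x)).1
    (norm_sub_proj_eq_iInf hne hc hK x) y hy

/-- **Thm 4.1 (⇐)** with uniqueness built in: a point `y₀ ∈ K` satisfying the variational
inequality IS `P_K(x)`. [cite: Deutsch2001, Thm 4.1] -/
theorem eq_proj_of_inner_le_zero (hne : K.Nonempty) (hc : IsComplete K) (hK : Convex ℝ K)
    (hy₀ : y₀ ∈ K) (h : ∀ y ∈ K, ⟪x - y₀, y - y₀⟫ ≤ 0) : y₀ = proj K x := by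
  have h1 : ⟪x - y₀, proj K x - y₀⟫ ≤ 0 := h _ (proj_mem hne hc hK x)
  have h2 : ⟪x - proj K x, y₀ - proj K x⟫ ≤ 0 := inner_sub_proj_le_zero hne hc hK x hy₀
  have key : ‖proj K x - y₀‖ ^ 2 = ⟪x - y₀, proj K x - y₀⟫ + ⟪x - proj K x, y₀ - proj K x⟫ := by
    have e1 : y₀ - proj K x = -(proj K x - y₀) := by abel
    rw [← real_inner_self_eq_norm_sq, e1, inner_neg_right, ← sub_eq_add_neg, ← inner_sub_left]
    congr 1
    abel
  have h3 : ‖proj K x - y₀‖ ^ 2 ≤ 0 := by rw [key]; linarith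
  have h4 : ‖proj K x - y₀‖ = 0 := by
    have h5 : ‖proj K x - y₀‖ ^ 2 = 0 := le_antisymm h3 (sq_nonneg _)
    exact pow_eq_zero_iff (n := 2) two_ne_zero |>.1 h5
  exact (sub_eq_zero.1 (norm_eq_zero.1 h4)).symm

/-- **Thm 4.1**: `y₀ = P_K(x) ⟺ y₀ ∈ K ∧ ⟨x − y₀, y − y₀⟩ ≤ 0 for all y ∈ K`.
[cite: Deutsch2001, Thm 4.1] -/
theorem eq_proj_iff (hne : K.Nonempty) (hc : IsComplete K) (hK : Convex ℝ K) :
    y₀ = proj K x ↔ y₀ ∈ K ∧ ∀ y ∈ K, ⟪x - y₀, y - y₀⟫ ≤ 0 := by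
  constructor
  · rintro rfl
    exact ⟨proj_mem hne hc hK x, fun y hy => inner_sub_proj_le_zero hne hc hK x hy⟩
  · rintro ⟨hy₀, h⟩
    exact eq_proj_of_inner_le_zero hne hc hK hy₀ h

/-- **Thm 2.4 (uniqueness of best approximations)**: a nearest point `y₀ ∈ K` of `x` is `P_K(x)`.
[cite: Deutsch2001, Thm 2.4] -/
theorem eq_proj_of_norm_sub_le (hne : K.Nonempty) (hc : IsComplete K) (hK : Convex ℝ K)
    (hy₀ : y₀ ∈ K) (h : ∀ y ∈ K, ‖x - y₀‖ ≤ ‖x - y‖) : y₀ = proj K x := by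
  haveI : Nonempty K := hne.to_subtype
  have hb : BddBelow (Set.range fun w : K => ‖x - (w : E)‖) :=
    ⟨0, by rintro _ ⟨w, rfl⟩; exact norm_nonneg _⟩
  have heq : ‖x - y₀‖ = ⨅ w : K, ‖x - (w : E)‖ :=
    le_antisymm (le_ciInf fun w => h w w.2) (ciInf_le hb ⟨y₀, hy₀⟩)
  exact eq_proj_of_inner_le_zero hne hc hK hy₀
    ((norm_eq_iInf_iff_real_inner_le_zero hK hy₀).1 heq)

/-! ## Theorem 5.5: idempotent, firmly nonexpansive, monotone, strictly nonexpansive, nonexpansive -/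

/-- **Thm 5.5 (1)**: points of `K` are their own best approximations, `P_K(y) = y` for `y ∈ K`.
[cite: Deutsch2001, Thm 5.5] -/
theorem proj_eq_self (hne : K.Nonempty) (hc : IsComplete K) (hK : Convex ℝ K) (hy : y ∈ K) :
    proj K y = y :=
  (eq_proj_of_norm_sub_le hne hc hK hy fun w _ => by simp).symm

/-- **Thm 5.5 (1)**: `P_K` is idempotent, `P_K(P_K(x)) = P_K(x)`. [cite: Deutsch2001, Thm 5.5] -/
theorem proj_proj (hne : K.Nonempty) (hc : IsComplete K) (hK : Convex ℝ K) (x : E) :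
    proj K (proj K x) = proj K x :=
  proj_eq_self hne hc hK (proj_mem hne hc hK x)

/-- `P_K(x) = x ⟺ x ∈ K`. [cite: Deutsch2001, Thm 5.5] -/
theorem proj_eq_self_iff (hne : K.Nonempty) (hc : IsComplete K) (hK : Convex ℝ K) :
    proj K x = x ↔ x ∈ K :=
  ⟨fun h => h ▸ proj_mem hne hc hK x, proj_eq_self hne hc hK⟩

/-- **Thm 5.5 (2)**: `P_K` is FIRMLY NONEXPANSIVE,
`‖P_K(x) − P_K(y)‖² ≤ ⟨x − y, P_K(x) − P_K(y)⟩`. [cite: Deutsch2001, Thm 5.5] -/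
theorem norm_proj_sub_proj_sq_le_inner (hne : K.Nonempty) (hc : IsComplete K) (hK : Convex ℝ K)
    (x y : E) : ‖proj K x - proj K y‖ ^ 2 ≤ ⟪x - y, proj K x - proj K y⟫ := by
  have e : x - y = (x - proj K x) + (proj K x - proj K y) - (y - proj K y) := by abel
  rw [e, inner_sub_left, inner_add_left, real_inner_self_eq_norm_sq]
  have a : ⟪x - proj K x, proj K y - proj K x⟫ ≤ 0 :=
    inner_sub_proj_le_zero hne hc hK x (proj_mem hne hc hK y)
  have a' : 0 ≤ ⟪x - proj K x, proj K x - proj K y⟫ := by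
    have e1 : proj K x - proj K y = -(proj K y - proj K x) := by abel
    rw [e1, inner_neg_right]
    linarith
  have b : ⟪y - proj K y, proj K x - proj K y⟫ ≤ 0 :=
    inner_sub_proj_le_zero hne hc hK y (proj_mem hne hc hK x)
  linarith

/-- **Thm 5.5 (3)**: `P_K` is MONOTONE, `0 ≤ ⟨x − y, P_K(x) − P_K(y)⟩`. [cite: Deutsch2001, Thm 5.5] -/
theorem inner_sub_proj_sub_proj_nonneg (hne : K.Nonempty) (hc : IsComplete K) (hK : Convex ℝ K)
    (x y : E) : 0 ≤ ⟪x - y, proj K x - proj K y⟫ :=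
  (sq_nonneg _).trans (norm_proj_sub_proj_sq_le_inner hne hc hK x y)

/-- **Thm 5.5 (4)**: `P_K` is "STRICTLY NONEXPANSIVE",
`‖P_K(x) − P_K(y)‖² + ‖(x − P_K(x)) − (y − P_K(y))‖² ≤ ‖x − y‖²`. [cite: Deutsch2001, Thm 5.5] -/
theorem norm_proj_sub_proj_sq_add_le (hne : K.Nonempty) (hc : IsComplete K) (hK : Convex ℝ K)
    (x y : E) :
    ‖proj K x - proj K y‖ ^ 2 + ‖(x - proj K x) - (y - proj K y)‖ ^ 2 ≤ ‖x - y‖ ^ 2 := by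
  have f := norm_proj_sub_proj_sq_le_inner hne hc hK x y
  have e : x - y = (proj K x - proj K y) + ((x - proj K x) - (y - proj K y)) := by abel
  have hb : ⟪proj K x - proj K y, (x - proj K x) - (y - proj K y)⟫ =
      ⟪x - y, proj K x - proj K y⟫ - ‖proj K x - proj K y‖ ^ 2 := by
    have e2 : (x - proj K x) - (y - proj K y) = (x - y) - (proj K x - proj K y) := by abel
    rw [e2, inner_sub_right, real_inner_self_eq_norm_sq, real_inner_comm (proj K x - proj K y)]
  have hxy : ‖x - y‖ ^ 2 = ‖proj K x - proj K y‖ ^ 2 +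
      2 * ⟪proj K x - proj K y, (x - proj K x) - (y - proj K y)⟫ +
      ‖(x - proj K x) - (y - proj K y)‖ ^ 2 := by
    rw [e, norm_add_sq_real]
  rw [hxy, hb]
  linarith

/-- **Thm 5.5 (5)**: `P_K` is NONEXPANSIVE, `‖P_K(x) − P_K(y)‖ ≤ ‖x − y‖`.
[cite: Deutsch2001, Thm 5.5] -/
theorem norm_proj_sub_proj_le (hne : K.Nonempty) (hc : IsComplete K) (hK : Convex ℝ K) (x y : E) :
    ‖proj K x - proj K y‖ ≤ ‖x - y‖ := by
  have h := norm_proj_sub_proj_sq_add_le hne hc hK x y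
  have h2 : 0 ≤ ‖(x - proj K x) - (y - proj K y)‖ ^ 2 := sq_nonneg _
  exact (sq_le_sq₀ (norm_nonneg _) (norm_nonneg _)).1 (by linarith)

/-- `P_K` is `1`-Lipschitz. [cite: Deutsch2001, Thm 5.5] -/
theorem lipschitzWith_proj (hne : K.Nonempty) (hc : IsComplete K) (hK : Convex ℝ K) :
    LipschitzWith 1 (proj K) :=
  LipschitzWith.of_dist_le_mul fun x y => by
    simpa only [NNReal.coe_one, one_mul, dist_eq_norm] using norm_proj_sub_proj_le hne hc hK x y

/-- **Thm 5.5 (6)**: `P_K` is uniformly continuous. [cite: Deutsch2001, Thm 5.5] -/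
theorem uniformContinuous_proj (hne : K.Nonempty) (hc : IsComplete K) (hK : Convex ℝ K) :
    UniformContinuous (proj K) :=
  (lipschitzWith_proj hne hc hK).uniformContinuous

/-- `P_K` is continuous. [cite: Deutsch2001, Thm 5.5] -/
theorem continuous_proj (hne : K.Nonempty) (hc : IsComplete K) (hK : Convex ℝ K) :
    Continuous (proj K) :=
  (lipschitzWith_proj hne hc hK).continuous

/-- **Thm 5.3**: the distance function `x ↦ d(x, K) = ‖x − P_K(x)‖` is nonexpansive,
`|d(x, K) − d(y, K)| ≤ ‖x − y‖`. [cite: Deutsch2001, Thm 5.3] -/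
theorem abs_norm_sub_proj_sub_le (hne : K.Nonempty) (hc : IsComplete K) (hK : Convex ℝ K)
    (x y : E) : |‖x - proj K x‖ - ‖y - proj K y‖| ≤ ‖x - y‖ := by
  have h1 : ‖x - proj K x‖ ≤ ‖x - y‖ + ‖y - proj K y‖ :=
    (norm_sub_proj_le hne hc hK x (proj_mem hne hc hK y)).trans (norm_sub_le_norm_sub_add_norm_sub _ _ _)
  have h2 : ‖y - proj K y‖ ≤ ‖y - x‖ + ‖x - proj K x‖ :=
    (norm_sub_proj_le hne hc hK y (proj_mem hne hc hK x)).trans (norm_sub_le_norm_sub_add_norm_sub _ _ _)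
  rw [norm_sub_rev y x] at h2
  rw [abs_sub_le_iff]
  constructor <;> linarith

/-! ## [GK90] Theorems 12.1–12.2: firm nonexpansiveness and the reflection -/

/-- The algebraic identity `(2 • a − x) − (2 • b − y) = 2 • (a − b) − (x − y)` used in the proof of
[GK90] Thm 12.1 (d) ⇒ (b) (private helper, plain module algebra). [folklore] -/
private theorem two_smul_sub_sub_two_smul_sub {F : Type*} [AddCommGroup F] [Module ℝ F]
    (a b x y : F) :
    ((2 : ℝ) • a - x) - ((2 : ℝ) • b - y) = (2 : ℝ) • (a - b) - (x - y) := by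
  simp only [smul_sub]
  abel

/-- **[GK90] Thm 12.1, (d) ⇒ (b)**: if `T : E → E` satisfies
`‖T x − T y‖² ≤ ⟨T x − T y, x − y⟩` for all `x, y` (firm nonexpansiveness in the form (12.6)), then
`S = 2T − I` is nonexpansive: `‖S x − S y‖² = 4‖T x − T y‖² − 4⟨T x − T y, x − y⟩ + ‖x − y‖² ≤ ‖x − y‖²`.
[cite: GoebelKirk1990, Thm 12.1] -/
theorem norm_two_smul_sub_le_of_sq_le_inner {T : E → E}
    (hT : ∀ x y, ‖T x - T y‖ ^ 2 ≤ ⟪T x - T y, x - y⟫) (x y : E) :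
    ‖((2 : ℝ) • T x - x) - ((2 : ℝ) • T y - y)‖ ≤ ‖x - y‖ := by
  have f := hT x y
  have hsq : ‖((2 : ℝ) • T x - x) - ((2 : ℝ) • T y - y)‖ ^ 2 ≤ ‖x - y‖ ^ 2 := by
    rw [two_smul_sub_sub_two_smul_sub, norm_sub_sq_real, norm_smul, real_inner_smul_left,
      Real.norm_eq_abs, abs_of_pos (by norm_num : (0 : ℝ) < 2), mul_pow]
    nlinarith [f]
  exact (sq_le_sq₀ (norm_nonneg _) (norm_nonneg _)).1 hsq

/-- **[GK90] Thm 12.2** (with [Deu01] Thm 5.5 (2)): `P_K` is firmly nonexpansive in the form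
(12.6), `‖P_K x − P_K y‖² ≤ ⟨P_K x − P_K y, x − y⟩`. [cite: GoebelKirk1990, Thm 12.2] -/
theorem norm_proj_sub_proj_sq_le_inner' (hne : K.Nonempty) (hc : IsComplete K) (hK : Convex ℝ K)
    (x y : E) : ‖proj K x - proj K y‖ ^ 2 ≤ ⟪proj K x - proj K y, x - y⟫ := by
  rw [real_inner_comm]
  exact norm_proj_sub_proj_sq_le_inner hne hc hK x y

/-- **[GK90] Thm 12.2**: the reflection `R_K = 2 P_K − I` of `E` in `K` is nonexpansive.
[cite: GoebelKirk1990, Thm 12.2] -/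
theorem norm_reflect_sub_reflect_le (hne : K.Nonempty) (hc : IsComplete K) (hK : Convex ℝ K)
    (x y : E) :
    ‖((2 : ℝ) • proj K x - x) - ((2 : ℝ) • proj K y - y)‖ ≤ ‖x - y‖ :=
  norm_two_smul_sub_le_of_sq_le_inner (norm_proj_sub_proj_sq_le_inner' hne hc hK) x y

/-- **[GK90] Thm 12.2**: `I − P_K` is nonexpansive, `‖(x − P_K x) − (y − P_K y)‖ ≤ ‖x − y‖`
(from [Deu01] Thm 5.5 (4)). [cite: GoebelKirk1990, Thm 12.2] -/
theorem norm_sub_proj_sub_le (hne : K.Nonempty) (hc : IsComplete K) (hK : Convex ℝ K) (x y : E) :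
    ‖(x - proj K x) - (y - proj K y)‖ ≤ ‖x - y‖ := by
  have h := norm_proj_sub_proj_sq_add_le hne hc hK x y
  have hsq : ‖(x - proj K x) - (y - proj K y)‖ ^ 2 ≤ ‖x - y‖ ^ 2 := by
    nlinarith [h, sq_nonneg ‖proj K x - proj K y‖]
  exact (sq_le_sq₀ (norm_nonneg _) (norm_nonneg _)).1 hsq

/-- **[GK90] Thm 12.2**: `I − P_K` is monotone, `⟨(x − P_K x) − (y − P_K y), x − y⟩ ≥ 0`
(indeed `≥ ‖(x − P_K x) − (y − P_K y)‖²`, from [Deu01] Thm 5.5 (2)). [cite: GoebelKirk1990, Thm 12.2] -/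
theorem inner_sub_proj_sub_nonneg (hne : K.Nonempty) (hc : IsComplete K) (hK : Convex ℝ K)
    (x y : E) : 0 ≤ ⟪(x - proj K x) - (y - proj K y), x - y⟫ := by
  have f := norm_proj_sub_proj_sq_le_inner hne hc hK x y
  have e : (x - proj K x) - (y - proj K y) = (x - y) - (proj K x - proj K y) := by abel
  rw [e, inner_sub_left, real_inner_self_eq_norm_sq, real_inner_comm]
  have hcs : ⟪x - y, proj K x - proj K y⟫ ≤ ‖x - y‖ * ‖proj K x - proj K y‖ :=
    real_inner_le_norm _ _
  have hn := norm_proj_sub_proj_le hne hc hK x y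
  nlinarith [hcs, hn, norm_nonneg (x - y), norm_nonneg (proj K x - proj K y)]

/-! ## Theorem 9.39: best approximation from a half-space -/

section HalfSpace

variable [CompleteSpace E]

/-- The closed half-space `H = {y : ⟨y, z⟩ ≤ c}` is nonempty, complete and convex (Thm 9.39 (1):
a Chebyshev half-space). [cite: Deutsch2001, Thm 9.39] -/
theorem halfspace_nonempty_isComplete_convex {z : E} (hz : z ≠ 0) (c : ℝ) :
    {y : E | ⟪y, z⟫ ≤ c}.Nonempty ∧ IsComplete {y : E | ⟪y, z⟫ ≤ c} ∧
      Convex ℝ {y : E | ⟪y, z⟫ ≤ c} := by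
  refine ⟨?_, ?_, ?_⟩
  · -- the point `(c / ‖z‖²) z` lies on the bounding hyperplane
    refine ⟨(c / ‖z‖ ^ 2) • z, ?_⟩
    have hz2 : ‖z‖ ^ 2 ≠ 0 := pow_ne_zero 2 (norm_ne_zero_iff.2 hz)
    simp only [Set.mem_setOf_eq, real_inner_smul_left, real_inner_self_eq_norm_sq]
    rw [div_mul_cancel₀ c hz2]
  · exact (isClosed_le (continuous_id.inner continuous_const) continuous_const).isComplete
  · have hlin : IsLinearMap ℝ fun y : E => ⟪y, z⟫ :=
      { map_add := fun a b => inner_add_left a b z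
        map_smul := fun r a => real_inner_smul_left a z r }
    simpa using (convex_halfSpace_le hlin c)

/-- **Thm 9.39 (2), (9.39.2)**: `P_H(x) = x − ([⟨x, z⟩ − c]⁺ / ‖z‖²) z` for the half-space
`H = {y : ⟨y, z⟩ ≤ c}`, `z ≠ 0`. [cite: Deutsch2001, Thm 9.39] -/
theorem proj_halfspace_eq {z : E} (hz : z ≠ 0) (c : ℝ) (x : E) :
    proj {y : E | ⟪y, z⟫ ≤ c} x = x - (max (⟪x, z⟫ - c) 0 / ‖z‖ ^ 2) • z := by
  obtain ⟨hne, hc, hK⟩ := halfspace_nonempty_isComplete_convex hz c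
  have hz2 : 0 < ‖z‖ ^ 2 := by positivity
  symm
  refine eq_proj_of_inner_le_zero hne hc hK ?_ ?_
  · -- membership: `⟨P_H x, z⟩ = ⟨x, z⟩ − [⟨x, z⟩ − c]⁺ ≤ c`
    simp only [Set.mem_setOf_eq, inner_sub_left, real_inner_smul_left, real_inner_self_eq_norm_sq]
    rw [div_mul_cancel₀ _ hz2.ne']
    have := le_max_left (⟪x, z⟫ - c) 0
    linarith
  · intro y hy
    simp only [Set.mem_setOf_eq] at hy
    have e : x - (x - (max (⟪x, z⟫ - c) 0 / ‖z‖ ^ 2) • z) = (max (⟪x, z⟫ - c) 0 / ‖z‖ ^ 2) • z := by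
      abel
    rw [e, real_inner_smul_left, inner_sub_right, inner_sub_right, real_inner_smul_right,
      real_inner_self_eq_norm_sq, real_inner_comm y z, real_inner_comm x z]
    rcases le_or_gt (⟪x, z⟫ - c) 0 with h | h
    · rw [max_eq_right h]
      simp
    · rw [max_eq_left h.le, div_mul_cancel₀ _ hz2.ne']
      have ht : 0 ≤ (⟪x, z⟫ - c) / ‖z‖ ^ 2 := div_nonneg h.le hz2.le
      have h' : ⟪y, z⟫ - (⟪x, z⟫ - (⟪x, z⟫ - c)) ≤ 0 := by linarith
      exact mul_nonpos_iff.2 (Or.inl ⟨ht, h'⟩)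

/-- **Thm 9.39 (2), (9.39.3)**: `d(x, H) = [⟨x, z⟩ − c]⁺ / ‖z‖`. [cite: Deutsch2001, Thm 9.39] -/
theorem norm_sub_proj_halfspace_eq {z : E} (hz : z ≠ 0) (c : ℝ) (x : E) :
    ‖x - proj {y : E | ⟪y, z⟫ ≤ c} x‖ = max (⟪x, z⟫ - c) 0 / ‖z‖ := by
  have hzn : 0 < ‖z‖ := norm_pos_iff.2 hz
  rw [proj_halfspace_eq hz c x, sub_sub_cancel, norm_smul, Real.norm_eq_abs,
    abs_of_nonneg (div_nonneg (le_max_right _ _) (sq_nonneg _)), pow_two, ← div_div,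
    div_mul_cancel₀ _ hzn.ne']

end HalfSpace

/-! ## Dictionary to the cone projection of `MoreauConeDecomposition` -/

/-- For a proper cone `K` (nonempty closed convex cone in a Hilbert space) the cone projection of
`Literature.Analysis.Convex.MoreauDecomposition` is this file's `proj ↑K`: both are nearest points of
`↑K`, and best approximations from a convex set are unique (**Thm 2.4**). [cite: Deutsch2001, Thm 2.4] -/
theorem moreauProj_eq_proj [CompleteSpace E] (K : ProperCone ℝ E) (x : E) :
    MoreauDecomposition.proj K x = proj (K : Set E) x :=
  eq_proj_of_norm_sub_le K.nonempty K.isClosed.isComplete K.convex MoreauDecomposition.proj_mem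
    fun _ hy => MoreauDecomposition.norm_sub_proj_le hy

end Literature.Analysis.Convex.ConvexMetricProjection
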